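import Summits.CriticalPhenomena.PercolationContinuityZ3.Theorems.Transplant.FKConnectivityAllQAntipodalMajMixMixed
import HarnessLib

/-!
# Connectivity correlation inequalities for `φ_{w,q}`, every `q > 0` — file 51c: **the MIX CRITERION for the `q`-free `maj₃`
# inequality** — the flow criterion (Theorem A of memo FROM-fk-2-g24-BLACKBOX §4) at the flow `f₁ = MIX`, `f₂ = f₃ = ½·ROOT`

Support file (`--supports stmt-CriticalPhenomena-4575`), FK sub-lane `prim-bschramm-fk-2` (gen 25); builds on p205010 (kernel theorem,
internal audit signed; external expert review pending).  No definitions, no named facts, no sorries; standard axioms.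

HOST: `H = E₁ ∪ E'`, two edge-disjoint two-terminal series–parallel networks between `a, b` meeting only in `{a, b}` (`ab ∉ E₁`); the
special edge `x₁ ∈ E₁`, the special edges `x₂ ≠ x₃ ∈ E'` ANYWHERE in `E'` (so `H` is the theta `Θ(B₁, B₂, B₃)` when `E' = B₂ ∥ B₃`, the
cycle `Δ(B₁, B₂, B₃)` when `E' = B₂ · B₃`, and every other position of two specials in a series–parallel block); a cell `N₁, C₁ ⊆ E₁`,
`N', C' ⊆ E'` (free / contracted) avoiding the specials; an antitone level weight `w`; an increasing `g` not reading the specials.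

HYPOTHESIS `hMIX` (the pair inequality MIX of the memo, §4.3, in functional form): for every test function `h` monotone on the
subsets of `N'` and every exact level `m`, the ROOT functional of `E'` (terminal-connection difference of the two replicas,
`FK.apUpcCLW`-type) restricted to the MIXED configurations — exactly one of `x₂, x₃` in the first replica — is nonnegative.

THEOREM `FK.apPsiCW_maj3_nonpos_of_mix`: then the weighted antipodal form of `maj₃(x₁,x₂,x₃)` against `g` on `H` in the cell
`(N₁ ∪ N', C₁ ∪ C')` is `≤ 0`, i.e. `Z_H(z,q)² Cov_{φ_{z,q}}(maj₃, g) ∈ (q−1)·ℝ≥0[z,q]` on this cell — for EVERY series–parallel `E₁`.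
PROOF (memo §4.1–4.3): pointwise in the pattern of the three specials, `−(maj − maj∘compl) = MIXED₁ + ½σ₂ + ½σ₃`; the `σ₂, σ₃` parts
are Theorem U at the pivots `x₂, x₃` of the re-rooted host (`FK.theta_U_pivot`); the `MIXED₁` part is glued from `E₁` and `E'`
(`FK.apExpC_parallel`) and its `x₁`-flips are grouped by the state of `E'`: both replicas join the poles → Theorem U for `x₁` with `ab`
contracted; neither → `ab` deleted; exactly one → the nested form of Theorem U with `ab` free (`FK.theta_U_pivot_nested`), whose
hypothesis `h₀ ≤ h₁` is `hMIX` read against the increments of `g` (`FK.apPsiCW_maj3_mixed_nonneg`, file 51b).  Corollaries: partial sums by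
level (`FK.apPsiC_levels_le_maj3_nonpos_of_mix`) and the `q`-form for `0 ≤ q ≤ 1` (`FK.apPsiC_maj3_nonpos_of_mix_of_levels`).  New
unconditional hosts follow from every discharge of `hMIX` (e.g. the MIX-clean word pairs of the memo, §4.3 (iii)).
[cite: Grimmett2006, §3.8 Thm. (3.90) (pp. 61–62); §3.9 (pp. 63–64)] [cite: Wagner2006, Thm. 5.8(d), §5.3]
-/

noncomputable section

namespace Summit.CriticalPhenomena.PercolationContinuityZ3.Theorems

namespace FK

open SimpleGraph Literature.Probability.LatticeModels Literature.Probability.Percolation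
open scoped Classical

variable {V : Type*} [Fintype V]

section Mix

variable {E₁ E' : Finset (Sym2 V)} {V₁ V' : Set V} {a b : V}

set_option linter.unusedSimpArgs false in
/-- **THEOREM (the MIX criterion for `maj₃`).**  See the module docstring.  `E₁, E'` TTSP between `a, b`, edge-disjoint, meeting only in
`{a, b}`, `ab ∉ E₁`; specials `x₁ = u₁v₁ ∈ E₁`, `x₂ = u₂v₂ ≠ x₃ = u₃v₃ ∈ E'`; cell `N₁, C₁ ⊆ E₁`, `N', C' ⊆ E'` off the specials;
`w` antitone; `g` increasing and blind to the specials; `hMIX` = the levelwise mixed root functional of `E'` is nonnegative against every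
monotone test function.  Then the weighted antipodal form of `maj₃` against `g` on `E₁ ∪ E'` is `≤ 0`.
[cite: Grimmett2006, §3.8 Thm. (3.90) (pp. 61–62); §3.9 (pp. 63–64)] [cite: Wagner2006, Thm. 5.8(d), §5.3] -/
theorem apPsiCW_maj3_nonpos_of_mix (hE₁ : IsTTSP E₁ a b) (hE' : IsTTSP E' a b) (hd : Disjoint E₁ E')
    (h₁ : ∀ e ∈ (↑E₁ : Set (Sym2 V)), ∀ z ∈ e, z ∈ V₁) (h' : ∀ e ∈ (↑E' : Set (Sym2 V)), ∀ z ∈ e, z ∈ V')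
    (hV : V₁ ∩ V' ⊆ {a, b}) (heE₁ : s(a, b) ∉ E₁)
    {u₁ v₁ u₂ v₂ u₃ v₃ : V} (hx₁ : s(u₁, v₁) ∈ E₁) (hx₂ : s(u₂, v₂) ∈ E') (hx₃ : s(u₃, v₃) ∈ E')
    (hx₂₃ : s(u₂, v₂) ≠ s(u₃, v₃))
    {N₁ C₁ N' C' : Finset (Sym2 V)} (hN₁ : N₁ ⊆ E₁) (hC₁ : C₁ ⊆ E₁) (hN' : N' ⊆ E') (hC' : C' ⊆ E')
    (hx₁N : s(u₁, v₁) ∉ N₁) (hx₁C : s(u₁, v₁) ∉ C₁) (hx₂N : s(u₂, v₂) ∉ N') (hx₂C : s(u₂, v₂) ∉ C')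
    (hx₃N : s(u₃, v₃) ∉ N') (hx₃C : s(u₃, v₃) ∉ C')
    {w : ℕ → ℝ} (hw : ∀ n : ℕ, w (n + 1) ≤ w n) {g : Finset (Sym2 V) → ℝ}
    (hg₁ : ∀ A : Finset (Sym2 V), g (insert s(u₁, v₁) A) = g A) (hg₂ : ∀ A : Finset (Sym2 V), g (insert s(u₂, v₂) A) = g A)
    (hg₃ : ∀ A : Finset (Sym2 V), g (insert s(u₃, v₃) A) = g A) (hmono : ∀ ⦃X Y : Finset (Sym2 V)⦄, X ⊆ Y → g X ≤ g Y)
    (hMIX : ∀ h : Finset (Sym2 V) → ℝ, (∀ ⦃A B : Finset (Sym2 V)⦄, A ⊆ B → B ⊆ N' → h A ≤ h B) → ∀ m : ℕ,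
      0 ≤ ∑ β ∈ N'.powerset, h β *
        ((if apExpC (insert s(u₂, v₂) (insert s(u₃, v₃) N')) C' (insert s(u₂, v₂) β) = m then
            apConn (insert s(u₂, v₂) β ∪ C') a b -
              apConn (insert s(u₂, v₂) (insert s(u₃, v₃) N') \ insert s(u₂, v₂) β ∪ C') a b else 0) +
          (if apExpC (insert s(u₂, v₂) (insert s(u₃, v₃) N')) C' (insert s(u₃, v₃) β) = m then
            apConn (insert s(u₃, v₃) β ∪ C') a b -
              apConn (insert s(u₂, v₂) (insert s(u₃, v₃) N') \ insert s(u₃, v₃) β ∪ C') a b else 0))) :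
    ∑ γ ∈ (insert s(u₁, v₁) N₁ ∪ insert s(u₂, v₂) (insert s(u₃, v₃) N')).powerset,
        w (apExpC (insert s(u₁, v₁) N₁ ∪ insert s(u₂, v₂) (insert s(u₃, v₃) N')) (C₁ ∪ C') γ) *
          ((((fun X : Finset (Sym2 V) => if (s(u₁, v₁) ∈ X ∧ s(u₂, v₂) ∈ X) ∨ (s(u₁, v₁) ∈ X ∧ s(u₃, v₃) ∈ X) ∨
                (s(u₂, v₂) ∈ X ∧ s(u₃, v₃) ∈ X) then (1 : ℝ) else 0) (γ ∪ (C₁ ∪ C'))) -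
              ((fun X : Finset (Sym2 V) => if (s(u₁, v₁) ∈ X ∧ s(u₂, v₂) ∈ X) ∨ (s(u₁, v₁) ∈ X ∧ s(u₃, v₃) ∈ X) ∨
                (s(u₂, v₂) ∈ X ∧ s(u₃, v₃) ∈ X) then (1 : ℝ) else 0)
                ((insert s(u₁, v₁) N₁ ∪ insert s(u₂, v₂) (insert s(u₃, v₃) N')) \ γ ∪ (C₁ ∪ C')))) *
            (g (γ ∪ (C₁ ∪ C')) - g ((insert s(u₁, v₁) N₁ ∪ insert s(u₂, v₂) (insert s(u₃, v₃) N')) \ γ ∪ (C₁ ∪ C')))) ≤ 0 := by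
  have hab : a ≠ b := hE₁.ne
  have hM₁E : insert s(u₁, v₁) N₁ ⊆ E₁ := Finset.insert_subset hx₁ hN₁
  have hM'E : insert s(u₂, v₂) (insert s(u₃, v₃) N') ⊆ E' := Finset.insert_subset hx₂ (Finset.insert_subset hx₃ hN')
  have nE' : ∀ {e : Sym2 V}, e ∈ E₁ → e ∉ E' := fun he he' => Finset.disjoint_left.1 hd he he'
  have nE₁ : ∀ {e : Sym2 V}, e ∈ E' → e ∉ E₁ := fun he' he => Finset.disjoint_left.1 hd he he'
  have hx₁C' : s(u₁, v₁) ∉ C' := fun h => nE' hx₁ (hC' h)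
  have hx₂M₁ : s(u₂, v₂) ∉ insert s(u₁, v₁) N₁ := fun h => nE₁ hx₂ (hM₁E h)
  have hx₃M₁ : s(u₃, v₃) ∉ insert s(u₁, v₁) N₁ := fun h => nE₁ hx₃ (hM₁E h)
  have hx₂C₁ : s(u₂, v₂) ∉ C₁ := fun h => nE₁ hx₂ (hC₁ h)
  have hx₃C₁ : s(u₃, v₃) ∉ C₁ := fun h => nE₁ hx₃ (hC₁ h)
  have hx₂N'' : s(u₂, v₂) ∉ insert s(u₃, v₃) N' := by rw [Finset.mem_insert, not_or]; exact ⟨hx₂₃, hx₂N⟩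
  have hx₁CC : s(u₁, v₁) ∉ C₁ ∪ C' := by rw [Finset.mem_union, not_or]; exact ⟨hx₁C, hx₁C'⟩
  have hx₂CC : s(u₂, v₂) ∉ C₁ ∪ C' := by rw [Finset.mem_union, not_or]; exact ⟨hx₂C₁, hx₂C⟩
  have hx₃CC : s(u₃, v₃) ∉ C₁ ∪ C' := by rw [Finset.mem_union, not_or]; exact ⟨hx₃C₁, hx₃C⟩
  have hx₁M : s(u₁, v₁) ∈ insert s(u₁, v₁) N₁ ∪ insert s(u₂, v₂) (insert s(u₃, v₃) N') :=
    Finset.mem_union_left _ (Finset.mem_insert_self _ _)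
  have hx₂M : s(u₂, v₂) ∈ insert s(u₁, v₁) N₁ ∪ insert s(u₂, v₂) (insert s(u₃, v₃) N') :=
    Finset.mem_union_right _ (Finset.mem_insert_self _ _)
  have hx₃M : s(u₃, v₃) ∈ insert s(u₁, v₁) N₁ ∪ insert s(u₂, v₂) (insert s(u₃, v₃) N') :=
    Finset.mem_union_right _ (Finset.mem_insert_of_mem (Finset.mem_insert_self _ _))
  set G : Finset (Sym2 V) → ℝ := fun X => g (X ∪ (C₁ ∪ C')) -
    g ((insert s(u₁, v₁) N₁ ∪ insert s(u₂, v₂) (insert s(u₃, v₃) N')) \ X ∪ (C₁ ∪ C')) with hGdef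
  have hGmono : ∀ ⦃X Y : Finset (Sym2 V)⦄, X ⊆ Y → G X ≤ G Y := fun X Y hXY => incr_mono hmono _ _ hXY
  have hG₂ : ∀ X : Finset (Sym2 V), G (insert s(u₂, v₂) X) = G X := fun X => incr_blind hg₂ _ _ X
  have hG₃ : ∀ X : Finset (Sym2 V), G (insert s(u₃, v₃) X) = G X := fun X => incr_blind hg₃ _ _ X
  have hVz : ∀ z : V, (∃ e ∈ E₁, z ∈ e) → (∃ e ∈ E', z ∈ e) → z = a ∨ z = b := by
    rintro z ⟨e, he, hz⟩ ⟨f, hf, hz'⟩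
    have := hV ⟨h₁ e he z hz, h' f hf z hz'⟩
    simpa using this
  have hH : IsTTSP (E₁ ∪ E') a b := hE₁.parallel hE' hd hVz
  have hne₂ : insert s(a, b) (E₁ ∪ E') ≠ {s(u₂, v₂)} := by
    intro h
    have : s(u₃, v₃) ∈ ({s(u₂, v₂)} : Finset (Sym2 V)) := h ▸ Finset.mem_insert_of_mem (Finset.mem_union_right _ hx₃)
    exact hx₂₃ (Finset.mem_singleton.1 this).symm
  have hne₃ : insert s(a, b) (E₁ ∪ E') ≠ {s(u₃, v₃)} := by
    intro h
    have : s(u₂, v₂) ∈ ({s(u₃, v₃)} : Finset (Sym2 V)) := h ▸ Finset.mem_insert_of_mem (Finset.mem_union_right _ hx₂)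
    exact hx₂₃ (Finset.mem_singleton.1 this)
  have hR₂ : IsTTSP ((insert s(a, b) (E₁ ∪ E')).erase s(u₂, v₂)) u₂ v₂ :=
    hH.reroot_erase (Finset.mem_insert_of_mem (Finset.mem_union_right _ hx₂)) hne₂
  have hR₃ : IsTTSP ((insert s(a, b) (E₁ ∪ E')).erase s(u₃, v₃)) u₃ v₃ :=
    hH.reroot_erase (Finset.mem_insert_of_mem (Finset.mem_union_right _ hx₃)) hne₃
  have subH : ∀ {e : Sym2 V} (x : Sym2 V), e ∈ E₁ ∪ E' → e ≠ x → e ∈ (insert s(a, b) (E₁ ∪ E')).erase x :=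
    fun x he hne => Finset.mem_erase.2 ⟨hne, Finset.mem_insert_of_mem he⟩
  have hM₂sub : insert s(u₁, v₁) N₁ ∪ insert s(u₃, v₃) N' ⊆ (insert s(a, b) (E₁ ∪ E')).erase s(u₂, v₂) := by
    intro e he
    rcases Finset.mem_union.1 he with he | he
    · exact subH _ (Finset.mem_union_left _ (hM₁E he)) (fun h => hx₂M₁ (h ▸ he))
    · rcases Finset.mem_insert.1 he with rfl | he
      · exact subH _ (Finset.mem_union_right _ hx₃) hx₂₃.symm
      · exact subH _ (Finset.mem_union_right _ (hN' he)) (fun h => hx₂N (h ▸ he))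
  have hM₃sub : insert s(u₁, v₁) N₁ ∪ insert s(u₂, v₂) N' ⊆ (insert s(a, b) (E₁ ∪ E')).erase s(u₃, v₃) := by
    intro e he
    rcases Finset.mem_union.1 he with he | he
    · exact subH _ (Finset.mem_union_left _ (hM₁E he)) (fun h => hx₃M₁ (h ▸ he))
    · rcases Finset.mem_insert.1 he with rfl | he
      · exact subH _ (Finset.mem_union_right _ hx₂) hx₂₃
      · exact subH _ (Finset.mem_union_right _ (hN' he)) (fun h => hx₃N (h ▸ he))
  have hCsub₂ : C₁ ∪ C' ⊆ (insert s(a, b) (E₁ ∪ E')).erase s(u₂, v₂) := fun e he => by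
    rcases Finset.mem_union.1 he with he | he
    · exact subH _ (Finset.mem_union_left _ (hC₁ he)) (fun h => hx₂C₁ (h ▸ he))
    · exact subH _ (Finset.mem_union_right _ (hC' he)) (fun h => hx₂C (h ▸ he))
  have hCsub₃ : C₁ ∪ C' ⊆ (insert s(a, b) (E₁ ∪ E')).erase s(u₃, v₃) := fun e he => by
    rcases Finset.mem_union.1 he with he | he
    · exact subH _ (Finset.mem_union_left _ (hC₁ he)) (fun h => hx₃C₁ (h ▸ he))
    · exact subH _ (Finset.mem_union_right _ (hC' he)) (fun h => hx₃C (h ▸ he))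
  have hx₂M₂ : s(u₂, v₂) ∉ insert s(u₁, v₁) N₁ ∪ insert s(u₃, v₃) N' := by
    rw [Finset.mem_union, not_or]; exact ⟨hx₂M₁, hx₂N''⟩
  have hx₃N'' : s(u₃, v₃) ∉ insert s(u₂, v₂) N' := by rw [Finset.mem_insert, not_or]; exact ⟨hx₂₃.symm, hx₃N⟩
  have hx₃M₃ : s(u₃, v₃) ∉ insert s(u₁, v₁) N₁ ∪ insert s(u₂, v₂) N' := by
    rw [Finset.mem_union, not_or]; exact ⟨hx₃M₁, hx₃N''⟩
  -- ### Step 1: the pointwise pattern identity  −F_maj = F_mix + ½σ₂ + ½σ₃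
  have step1 : ∑ γ ∈ (insert s(u₁, v₁) N₁ ∪ insert s(u₂, v₂) (insert s(u₃, v₃) N')).powerset,
        w (apExpC (insert s(u₁, v₁) N₁ ∪ insert s(u₂, v₂) (insert s(u₃, v₃) N')) (C₁ ∪ C') γ) *
          ((((fun X : Finset (Sym2 V) => if (s(u₁, v₁) ∈ X ∧ s(u₂, v₂) ∈ X) ∨ (s(u₁, v₁) ∈ X ∧ s(u₃, v₃) ∈ X) ∨
                (s(u₂, v₂) ∈ X ∧ s(u₃, v₃) ∈ X) then (1 : ℝ) else 0) (γ ∪ (C₁ ∪ C'))) -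
              ((fun X : Finset (Sym2 V) => if (s(u₁, v₁) ∈ X ∧ s(u₂, v₂) ∈ X) ∨ (s(u₁, v₁) ∈ X ∧ s(u₃, v₃) ∈ X) ∨
                (s(u₂, v₂) ∈ X ∧ s(u₃, v₃) ∈ X) then (1 : ℝ) else 0)
                ((insert s(u₁, v₁) N₁ ∪ insert s(u₂, v₂) (insert s(u₃, v₃) N')) \ γ ∪ (C₁ ∪ C')))) *
            (g (γ ∪ (C₁ ∪ C')) - g ((insert s(u₁, v₁) N₁ ∪ insert s(u₂, v₂) (insert s(u₃, v₃) N')) \ γ ∪ (C₁ ∪ C')))) =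
      -((∑ γ ∈ (insert s(u₁, v₁) N₁ ∪ insert s(u₂, v₂) (insert s(u₃, v₃) N')).powerset,
          w (apExpC (insert s(u₁, v₁) N₁ ∪ insert s(u₂, v₂) (insert s(u₃, v₃) N')) (C₁ ∪ C') γ) *
            (((if s(u₁, v₁) ∈ γ then (-1 : ℝ) else 1) *
              (if (s(u₂, v₂) ∈ γ ∧ s(u₃, v₃) ∉ γ) ∨ (s(u₂, v₂) ∉ γ ∧ s(u₃, v₃) ∈ γ) then (1 : ℝ) else 0)) * G γ)) +
        (1 / 2) * ∑ γ ∈ (insert s(u₁, v₁) N₁ ∪ insert s(u₂, v₂) (insert s(u₃, v₃) N')).powerset,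
          G γ * (if s(u₂, v₂) ∈ γ then (-1 : ℝ) else 1) *
            w (apExpC (insert s(u₁, v₁) N₁ ∪ insert s(u₂, v₂) (insert s(u₃, v₃) N')) (C₁ ∪ C') γ + 0) +
        (1 / 2) * ∑ γ ∈ (insert s(u₁, v₁) N₁ ∪ insert s(u₂, v₂) (insert s(u₃, v₃) N')).powerset,
          G γ * (if s(u₃, v₃) ∈ γ then (-1 : ℝ) else 1) *
            w (apExpC (insert s(u₁, v₁) N₁ ∪ insert s(u₂, v₂) (insert s(u₃, v₃) N')) (C₁ ∪ C') γ + 0)) := by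
    rw [Finset.mul_sum, Finset.mul_sum, ← Finset.sum_add_distrib, ← Finset.sum_add_distrib, ← Finset.sum_neg_distrib]
    refine Finset.sum_congr rfl fun γ hγ => ?_
    have hγM := Finset.mem_powerset.1 hγ
    have m₁ : (s(u₁, v₁) ∈ γ ∪ (C₁ ∪ C')) ↔ s(u₁, v₁) ∈ γ := by rw [Finset.mem_union, or_iff_left hx₁CC]
    have m₂ : (s(u₂, v₂) ∈ γ ∪ (C₁ ∪ C')) ↔ s(u₂, v₂) ∈ γ := by rw [Finset.mem_union, or_iff_left hx₂CC]
    have m₃ : (s(u₃, v₃) ∈ γ ∪ (C₁ ∪ C')) ↔ s(u₃, v₃) ∈ γ := by rw [Finset.mem_union, or_iff_left hx₃CC]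
    have n₁ : (s(u₁, v₁) ∈ (insert s(u₁, v₁) N₁ ∪ insert s(u₂, v₂) (insert s(u₃, v₃) N')) \ γ ∪ (C₁ ∪ C')) ↔
        ¬ s(u₁, v₁) ∈ γ := by
      rw [Finset.mem_union, or_iff_left hx₁CC, Finset.mem_sdiff, and_iff_right hx₁M]
    have n₂ : (s(u₂, v₂) ∈ (insert s(u₁, v₁) N₁ ∪ insert s(u₂, v₂) (insert s(u₃, v₃) N')) \ γ ∪ (C₁ ∪ C')) ↔
        ¬ s(u₂, v₂) ∈ γ := by
      rw [Finset.mem_union, or_iff_left hx₂CC, Finset.mem_sdiff, and_iff_right hx₂M]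
    have n₃ : (s(u₃, v₃) ∈ (insert s(u₁, v₁) N₁ ∪ insert s(u₂, v₂) (insert s(u₃, v₃) N')) \ γ ∪ (C₁ ∪ C')) ↔
        ¬ s(u₃, v₃) ∈ γ := by
      rw [Finset.mem_union, or_iff_left hx₃CC, Finset.mem_sdiff, and_iff_right hx₃M]
    have key := maj3_pattern_pointwise (s(u₁, v₁) ∈ γ) (s(u₂, v₂) ∈ γ) (s(u₃, v₃) ∈ γ)
    simp only [m₁, m₂, m₃, n₁, n₂, n₃, add_zero]
    have hGγ : G γ = g (γ ∪ (C₁ ∪ C')) - g ((insert s(u₁, v₁) N₁ ∪ insert s(u₂, v₂) (insert s(u₃, v₃) N')) \ γ ∪ (C₁ ∪ C')) := rfl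
    rw [hGγ]
    linear_combination (-(w (apExpC (insert s(u₁, v₁) N₁ ∪ insert s(u₂, v₂) (insert s(u₃, v₃) N')) (C₁ ∪ C') γ) *
      (g (γ ∪ (C₁ ∪ C')) - g ((insert s(u₁, v₁) N₁ ∪ insert s(u₂, v₂) (insert s(u₃, v₃) N')) \ γ ∪ (C₁ ∪ C'))))) * key
  -- ### Step 2: Theorem U at the pivots `x₂`, `x₃` of the host
  have S₂ : 0 ≤ ∑ γ ∈ (insert s(u₁, v₁) N₁ ∪ insert s(u₂, v₂) (insert s(u₃, v₃) N')).powerset,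
      G γ * (if s(u₂, v₂) ∈ γ then (-1 : ℝ) else 1) *
        w (apExpC (insert s(u₁, v₁) N₁ ∪ insert s(u₂, v₂) (insert s(u₃, v₃) N')) (C₁ ∪ C') γ + 0) := by
    have key := theta_U_pivot hR₂ hM₂sub hCsub₂ hx₂M₂ hw (H := G) (fun X Y hXY _ => hGmono hXY) hG₂ 0
    rw [← Finset.union_insert] at key
    exact key
  have S₃ : 0 ≤ ∑ γ ∈ (insert s(u₁, v₁) N₁ ∪ insert s(u₂, v₂) (insert s(u₃, v₃) N')).powerset,
      G γ * (if s(u₃, v₃) ∈ γ then (-1 : ℝ) else 1) *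
        w (apExpC (insert s(u₁, v₁) N₁ ∪ insert s(u₂, v₂) (insert s(u₃, v₃) N')) (C₁ ∪ C') γ + 0) := by
    have key := theta_U_pivot hR₃ hM₃sub hCsub₃ hx₃M₃ hw (H := G) (fun X Y hXY _ => hGmono hXY) hG₃ 0
    rw [← Finset.union_insert, Finset.insert_comm] at key
    exact key
  -- ### Step 3: the MIXED part (file 51b)
  have Smix := apPsiCW_maj3_mixed_nonneg hE₁ hd h₁ h' hV heE₁ hx₁ hx₂ hx₃ hx₂₃ hN₁ hC₁ hN' hC' hx₁N hx₁C hx₂N hx₃N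
    hw hg₁ hg₂ hg₃ hmono hMIX
  rw [step1, neg_nonpos]
  have h2 : (0 : ℝ) ≤ 1 / 2 := by norm_num
  exact add_nonneg (add_nonneg Smix (mul_nonneg h2 S₂)) (mul_nonneg h2 S₃)

/-- **COROLLARY (partial sums by cluster level): under `hMIX`, every coefficient — in the edge odds AND in `q` — of
`Z_H(z,q)² Cov_{φ_{z,q}}(maj₃, g)/(q−1)` is nonnegative on the host `E₁ ∪ E'` (the `q`-free form of Conjecture `C_∞⁺` for `maj₃` there).**
[cite: Grimmett2006, §3.8 Thm. (3.90) (pp. 61–62)] [cite: Wagner2006, Thm. 5.8(d), §5.3] -/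
theorem apPsiC_levels_le_maj3_nonpos_of_mix (hE₁ : IsTTSP E₁ a b) (hE' : IsTTSP E' a b) (hd : Disjoint E₁ E')
    (h₁ : ∀ e ∈ (↑E₁ : Set (Sym2 V)), ∀ z ∈ e, z ∈ V₁) (h' : ∀ e ∈ (↑E' : Set (Sym2 V)), ∀ z ∈ e, z ∈ V')
    (hV : V₁ ∩ V' ⊆ {a, b}) (heE₁ : s(a, b) ∉ E₁)
    {u₁ v₁ u₂ v₂ u₃ v₃ : V} (hx₁ : s(u₁, v₁) ∈ E₁) (hx₂ : s(u₂, v₂) ∈ E') (hx₃ : s(u₃, v₃) ∈ E')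
    (hx₂₃ : s(u₂, v₂) ≠ s(u₃, v₃))
    {N₁ C₁ N' C' : Finset (Sym2 V)} (hN₁ : N₁ ⊆ E₁) (hC₁ : C₁ ⊆ E₁) (hN' : N' ⊆ E') (hC' : C' ⊆ E')
    (hx₁N : s(u₁, v₁) ∉ N₁) (hx₁C : s(u₁, v₁) ∉ C₁) (hx₂N : s(u₂, v₂) ∉ N') (hx₂C : s(u₂, v₂) ∉ C')
    (hx₃N : s(u₃, v₃) ∉ N') (hx₃C : s(u₃, v₃) ∉ C')
    (J : ℕ) {g : Finset (Sym2 V) → ℝ}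
    (hg₁ : ∀ A : Finset (Sym2 V), g (insert s(u₁, v₁) A) = g A) (hg₂ : ∀ A : Finset (Sym2 V), g (insert s(u₂, v₂) A) = g A)
    (hg₃ : ∀ A : Finset (Sym2 V), g (insert s(u₃, v₃) A) = g A) (hmono : ∀ ⦃X Y : Finset (Sym2 V)⦄, X ⊆ Y → g X ≤ g Y)
    (hMIX : ∀ h : Finset (Sym2 V) → ℝ, (∀ ⦃A B : Finset (Sym2 V)⦄, A ⊆ B → B ⊆ N' → h A ≤ h B) → ∀ m : ℕ,
      0 ≤ ∑ β ∈ N'.powerset, h β *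
        ((if apExpC (insert s(u₂, v₂) (insert s(u₃, v₃) N')) C' (insert s(u₂, v₂) β) = m then
            apConn (insert s(u₂, v₂) β ∪ C') a b -
              apConn (insert s(u₂, v₂) (insert s(u₃, v₃) N') \ insert s(u₂, v₂) β ∪ C') a b else 0) +
          (if apExpC (insert s(u₂, v₂) (insert s(u₃, v₃) N')) C' (insert s(u₃, v₃) β) = m then
            apConn (insert s(u₃, v₃) β ∪ C') a b -
              apConn (insert s(u₂, v₂) (insert s(u₃, v₃) N') \ insert s(u₃, v₃) β ∪ C') a b else 0))) :
    ∑ γ ∈ (insert s(u₁, v₁) N₁ ∪ insert s(u₂, v₂) (insert s(u₃, v₃) N')).powerset with apExpC (insert s(u₁, v₁) N₁ ∪ insert s(u₂, v₂) (insert s(u₃, v₃) N')) (C₁ ∪ C') γ ≤ J,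
        (((fun X : Finset (Sym2 V) => if (s(u₁, v₁) ∈ X ∧ s(u₂, v₂) ∈ X) ∨ (s(u₁, v₁) ∈ X ∧ s(u₃, v₃) ∈ X) ∨
                (s(u₂, v₂) ∈ X ∧ s(u₃, v₃) ∈ X) then (1 : ℝ) else 0) (γ ∪ (C₁ ∪ C'))) -
            ((fun X : Finset (Sym2 V) => if (s(u₁, v₁) ∈ X ∧ s(u₂, v₂) ∈ X) ∨ (s(u₁, v₁) ∈ X ∧ s(u₃, v₃) ∈ X) ∨
                (s(u₂, v₂) ∈ X ∧ s(u₃, v₃) ∈ X) then (1 : ℝ) else 0)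
              ((insert s(u₁, v₁) N₁ ∪ insert s(u₂, v₂) (insert s(u₃, v₃) N')) \ γ ∪ (C₁ ∪ C')))) *
          (g (γ ∪ (C₁ ∪ C')) - g ((insert s(u₁, v₁) N₁ ∪ insert s(u₂, v₂) (insert s(u₃, v₃) N')) \ γ ∪ (C₁ ∪ C'))) ≤ 0 := by
  have key := apPsiCW_maj3_nonpos_of_mix hE₁ hE' hd h₁ h' hV heE₁ hx₁ hx₂ hx₃ hx₂₃ hN₁ hC₁ hN' hC' hx₁N hx₁C hx₂N hx₂C hx₃N hx₃C (w := fun n => if n ≤ J then (1 : ℝ) else 0)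
    (fun n => by
      split_ifs with h1 h2 h2
      · exact le_rfl
      · exact absurd ((Nat.le_succ n).trans h1) h2
      · exact zero_le_one
      · exact le_rfl) hg₁ hg₂ hg₃ hmono hMIX
  rw [Finset.sum_filter]
  refine le_of_eq_of_le (Finset.sum_congr rfl fun γ _ => ?_) key
  split_ifs <;> ring

/-- **COROLLARY (the `q`-form for all `0 ≤ q ≤ 1`, via the Abel bridge of `…Qfree`): under `hMIX`, `apPsiC q M C maj₃ g ≤ 0` on the host
`E₁ ∪ E'` — negative correlation of `maj₃(ω_{x₁},ω_{x₂},ω_{x₃})` with every increasing `g` in every cell, coefficientwise in the odds.**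
[cite: Grimmett2006, §3.8 Thm. (3.90) (pp. 61–62); §3.9 (pp. 63–64)] [cite: Wagner2006, Thm. 5.8(d), §5.3] -/
theorem apPsiC_maj3_nonpos_of_mix_of_levels (hE₁ : IsTTSP E₁ a b) (hE' : IsTTSP E' a b) (hd : Disjoint E₁ E')
    (h₁ : ∀ e ∈ (↑E₁ : Set (Sym2 V)), ∀ z ∈ e, z ∈ V₁) (h' : ∀ e ∈ (↑E' : Set (Sym2 V)), ∀ z ∈ e, z ∈ V')
    (hV : V₁ ∩ V' ⊆ {a, b}) (heE₁ : s(a, b) ∉ E₁)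
    {u₁ v₁ u₂ v₂ u₃ v₃ : V} (hx₁ : s(u₁, v₁) ∈ E₁) (hx₂ : s(u₂, v₂) ∈ E') (hx₃ : s(u₃, v₃) ∈ E')
    (hx₂₃ : s(u₂, v₂) ≠ s(u₃, v₃))
    {N₁ C₁ N' C' : Finset (Sym2 V)} (hN₁ : N₁ ⊆ E₁) (hC₁ : C₁ ⊆ E₁) (hN' : N' ⊆ E') (hC' : C' ⊆ E')
    (hx₁N : s(u₁, v₁) ∉ N₁) (hx₁C : s(u₁, v₁) ∉ C₁) (hx₂N : s(u₂, v₂) ∉ N') (hx₂C : s(u₂, v₂) ∉ C')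
    (hx₃N : s(u₃, v₃) ∉ N') (hx₃C : s(u₃, v₃) ∉ C')
    {q : ℝ} (hq0 : 0 ≤ q) (hq1 : q ≤ 1) {g : Finset (Sym2 V) → ℝ}
    (hg₁ : ∀ A : Finset (Sym2 V), g (insert s(u₁, v₁) A) = g A) (hg₂ : ∀ A : Finset (Sym2 V), g (insert s(u₂, v₂) A) = g A)
    (hg₃ : ∀ A : Finset (Sym2 V), g (insert s(u₃, v₃) A) = g A) (hmono : ∀ ⦃X Y : Finset (Sym2 V)⦄, X ⊆ Y → g X ≤ g Y)
    (hMIX : ∀ h : Finset (Sym2 V) → ℝ, (∀ ⦃A B : Finset (Sym2 V)⦄, A ⊆ B → B ⊆ N' → h A ≤ h B) → ∀ m : ℕ,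
      0 ≤ ∑ β ∈ N'.powerset, h β *
        ((if apExpC (insert s(u₂, v₂) (insert s(u₃, v₃) N')) C' (insert s(u₂, v₂) β) = m then
            apConn (insert s(u₂, v₂) β ∪ C') a b -
              apConn (insert s(u₂, v₂) (insert s(u₃, v₃) N') \ insert s(u₂, v₂) β ∪ C') a b else 0) +
          (if apExpC (insert s(u₂, v₂) (insert s(u₃, v₃) N')) C' (insert s(u₃, v₃) β) = m then
            apConn (insert s(u₃, v₃) β ∪ C') a b -
              apConn (insert s(u₂, v₂) (insert s(u₃, v₃) N') \ insert s(u₃, v₃) β ∪ C') a b else 0))) :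
    apPsiC q (insert s(u₁, v₁) N₁ ∪ insert s(u₂, v₂) (insert s(u₃, v₃) N')) (C₁ ∪ C')
      (fun X : Finset (Sym2 V) => if (s(u₁, v₁) ∈ X ∧ s(u₂, v₂) ∈ X) ∨ (s(u₁, v₁) ∈ X ∧ s(u₃, v₃) ∈ X) ∨
                (s(u₂, v₂) ∈ X ∧ s(u₃, v₃) ∈ X) then (1 : ℝ) else 0) g ≤ 0 :=
  sum_pow_mul_nonpos_of_levels_le (insert s(u₁, v₁) N₁ ∪ insert s(u₂, v₂) (insert s(u₃, v₃) N')).powerset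
    (apExpC (insert s(u₁, v₁) N₁ ∪ insert s(u₂, v₂) (insert s(u₃, v₃) N')) (C₁ ∪ C'))
    (fun γ => (((fun X : Finset (Sym2 V) => if (s(u₁, v₁) ∈ X ∧ s(u₂, v₂) ∈ X) ∨ (s(u₁, v₁) ∈ X ∧ s(u₃, v₃) ∈ X) ∨
                (s(u₂, v₂) ∈ X ∧ s(u₃, v₃) ∈ X) then (1 : ℝ) else 0) (γ ∪ (C₁ ∪ C'))) -
      ((fun X : Finset (Sym2 V) => if (s(u₁, v₁) ∈ X ∧ s(u₂, v₂) ∈ X) ∨ (s(u₁, v₁) ∈ X ∧ s(u₃, v₃) ∈ X) ∨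
                (s(u₂, v₂) ∈ X ∧ s(u₃, v₃) ∈ X) then (1 : ℝ) else 0) ((insert s(u₁, v₁) N₁ ∪ insert s(u₂, v₂) (insert s(u₃, v₃) N')) \ γ ∪ (C₁ ∪ C')))) *
      (g (γ ∪ (C₁ ∪ C')) - g ((insert s(u₁, v₁) N₁ ∪ insert s(u₂, v₂) (insert s(u₃, v₃) N')) \ γ ∪ (C₁ ∪ C'))))
    hq0 hq1 fun J => apPsiC_levels_le_maj3_nonpos_of_mix hE₁ hE' hd h₁ h' hV heE₁ hx₁ hx₂ hx₃ hx₂₃ hN₁ hC₁ hN' hC' hx₁N hx₁C hx₂N hx₂C hx₃N hx₃C J hg₁ hg₂ hg₃ hmono hMIX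

end Mix

end FK

end Summit.CriticalPhenomena.PercolationContinuityZ3.Theorems

end
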